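import Literature.Analysis.FluidPDE.FiniteFourierModeEulerLoop
import Literature.Analysis.FluidPDE.FiniteFourierModeEulerWedge

/-!
# Solid angles III: Girard's theorem

Support file for `FiniteFourierModeEuler` (N. Kishimoto, T. Yoneda, J. Math. Fluid Mech. 24
(2022) 74 = arXiv:2110.08039), continuing `FiniteFourierModeEulerWedge`: by inclusion–exclusion over
the eight open octants cut out by three planes through the origin (and the symmetry `x ↦ -x` of
Lebesgue measure and of the round ball) we prove **Girard's theorem** in volume form: the open
trihedral cone positively spanned by `(a, b, c)` meets the round ball in the fraction
`(θ_a + θ_b + θ_c - π) / (4π)` of its volume, `θ_a, θ_b, θ_c ∈ (0, π)` its dihedral angles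
(`girard`). This is the `p = 3` case of the Gauss–Bonnet formula `A(F*) = Θ(F*) - (p - 2)π` used in
Lemma 4.6; general polygons are handled by fan triangulation and additivity of volume.

## References

* [KishimotoYoneda2022] N. Kishimoto, T. Yoneda, J. Math. Fluid Mech. 24 (2022) 74 =
  arXiv:2110.08039, §4 Lemma 4.6 ("the celebrated Gauss–Bonnet theorem tells us that
  `A(F*) = Θ(F*) - (p-2)π`").
* [folklore] A. Girard, *Invention nouvelle en l'algèbre* (1629): area of a spherical triangle.
-/

noncomputable section

open MeasureTheory Set Real ENNReal Matrix

namespace Literature.Analysis.FluidPDE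

namespace KY

/-! ### Girard's theorem by inclusion–exclusion over the eight octants -/

section Girard

/-- A plane through the origin is a Lebesgue null set. [folklore] -/
theorem volume_plane_eq_zero {n : Fin 3 → ℝ} (hn : n ≠ 0) :
    volume {x : Fin 3 → ℝ | x ⬝ᵥ n = 0} = 0 := by
  let W : Submodule ℝ (Fin 3 → ℝ) :=
    { carrier := {x | x ⬝ᵥ n = 0}
      add_mem' := by
        intro a b ha hb; simp only [Set.mem_setOf_eq] at *; rw [add_dotProduct, ha, hb, add_zero]
      zero_mem' := by simp
      smul_mem' := by
        intro c x hx; simp only [Set.mem_setOf_eq] at *; rw [smul_dotProduct, hx, smul_zero] }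
  have hW : W ≠ ⊤ := by
    intro h
    have hmem : n ∈ W := by rw [h]; trivial
    exact hn (dotProduct_self_eq_zero.mp hmem)
  exact Measure.addHaar_submodule (volume : Measure (Fin 3 → ℝ)) W hW

/-- Splitting a measurable set by a plane through the origin. [folklore] -/
theorem volume_eq_add_halfSpace {A : Set (Fin 3 → ℝ)} (hA : MeasurableSet A) {n : Fin 3 → ℝ}
    (hn : n ≠ 0) : volume A = volume (A ∩ halfSpace n) + volume (A ∩ halfSpace (-n)) := by
  have hdisj : Disjoint (A ∩ halfSpace n) (A ∩ halfSpace (-n)) := by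
    rw [Set.disjoint_left]
    rintro x ⟨-, h1⟩ ⟨-, h2⟩
    simp only [halfSpace, mem_setOf_eq, dotProduct_neg] at h1 h2
    linarith
  have hm2 : MeasurableSet (A ∩ halfSpace (-n)) := hA.inter (measurableSet_halfSpace _)
  have hunion := measure_union hdisj hm2 (μ := volume)
  rw [← hunion]
  apply le_antisymm
  · calc volume A ≤ volume ((A ∩ halfSpace n ∪ A ∩ halfSpace (-n)) ∪ {x | x ⬝ᵥ n = 0}) := by
          apply measure_mono
          intro x hx
          rcases lt_trichotomy 0 (x ⬝ᵥ n) with h | h | h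
          · exact Or.inl (Or.inl ⟨hx, h⟩)
          · exact Or.inr h.symm
          · refine Or.inl (Or.inr ⟨hx, ?_⟩)
            simp only [halfSpace, mem_setOf_eq, dotProduct_neg]; linarith
      _ ≤ volume (A ∩ halfSpace n ∪ A ∩ halfSpace (-n)) + volume {x : Fin 3 → ℝ | x ⬝ᵥ n = 0} :=
          measure_union_le _ _
      _ = volume (A ∩ halfSpace n ∪ A ∩ halfSpace (-n)) := by rw [volume_plane_eq_zero hn, add_zero]
  · exact measure_mono (union_subset inter_subset_left inter_subset_left)

/-- The round ball and the half spaces are symmetric under `x ↦ -x`, which preserves volume.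
[folklore] -/
theorem volume_inter_halfSpaces_neg (R : ℝ) (n₁ n₂ n₃ : Fin 3 → ℝ) :
    volume (ball₃ R ∩ halfSpace (-n₁) ∩ halfSpace (-n₂) ∩ halfSpace (-n₃))
      = volume (ball₃ R ∩ halfSpace n₁ ∩ halfSpace n₂ ∩ halfSpace n₃) := by
  have hset : (fun x : Fin 3 → ℝ => -x) ⁻¹' (ball₃ R ∩ halfSpace n₁ ∩ halfSpace n₂ ∩ halfSpace n₃)
      = ball₃ R ∩ halfSpace (-n₁) ∩ halfSpace (-n₂) ∩ halfSpace (-n₃) := by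
    ext x; simp [ball₃, halfSpace, neg_dotProduct, dotProduct_neg]
  have hmeas : MeasurableSet (ball₃ R ∩ halfSpace n₁ ∩ halfSpace n₂ ∩ halfSpace n₃) :=
    (((measurableSet_ball₃ R).inter (measurableSet_halfSpace _)).inter
      (measurableSet_halfSpace _)).inter (measurableSet_halfSpace _)
  rw [← hset, ← Measure.map_apply measurable_neg hmeas, Measure.map_neg_eq_self]

variable {a b c : Fin 3 → ℝ}

/-- The open trihedral cone positively spanned by `a, b, c` (for `[a, b, c] > 0`):
`{x | [x,b,c] > 0, [a,x,c] > 0, [a,b,x] > 0}`. [folklore] -/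
def triCone (a b c : Fin 3 → ℝ) : Set (Fin 3 → ℝ) :=
  halfSpace (b ⨯₃ c) ∩ halfSpace (c ⨯₃ a) ∩ halfSpace (a ⨯₃ b)

/-- The open trihedral cone is measurable. [folklore] -/
theorem measurableSet_triCone (a b c : Fin 3 → ℝ) : MeasurableSet (triCone a b c) :=
  ((measurableSet_halfSpace _).inter (measurableSet_halfSpace _)).inter (measurableSet_halfSpace _)

/-- The dihedral angle of the trihedral cone `(a, b, c)` along the edge `a`: the opening angle of
the lune between the faces `(c, a)` and `(a, b)`, `arccos( -((c × a)·(a × b)) / (|c × a||a × b|) )`.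
[folklore] -/
def dihedral (c a b : Fin 3 → ℝ) : ℝ := luneAngle (c ⨯₃ a) (a ⨯₃ b)

/-- **Girard's theorem (volume form): the inclusion–exclusion identity.** For any three planes
through the origin with independent normals... stated for the cone `(a,b,c)`:
`2(|L_a| + |L_b| + |L_c|) = 4|T| + |B|` for the three lunes and the trihedral cone inside the
ball. [folklore] -/
theorem two_mul_sum_lunes (R : ℝ) (ha : b ⨯₃ c ≠ 0) (hb : c ⨯₃ a ≠ 0) (hc : a ⨯₃ b ≠ 0) :
    2 * (volume (lune (c ⨯₃ a) (a ⨯₃ b) ∩ ball₃ R) + volume (lune (a ⨯₃ b) (b ⨯₃ c) ∩ ball₃ R)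
        + volume (lune (b ⨯₃ c) (c ⨯₃ a) ∩ ball₃ R))
      = 4 * volume (triCone a b c ∩ ball₃ R) + volume (ball₃ R) := by
  -- name the normals and the four essentially different octants
  set na := b ⨯₃ c
  set nb := c ⨯₃ a
  set nc := a ⨯₃ b
  have hB := measurableSet_ball₃ R
  have hH := fun n : Fin 3 → ℝ => measurableSet_halfSpace n
  set P := volume (ball₃ R ∩ halfSpace na ∩ halfSpace nb ∩ halfSpace nc) with hP
  set Qa := volume (ball₃ R ∩ halfSpace (-na) ∩ halfSpace nb ∩ halfSpace nc) with hQa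
  set Qb := volume (ball₃ R ∩ halfSpace na ∩ halfSpace (-nb) ∩ halfSpace nc) with hQb
  set Qc := volume (ball₃ R ∩ halfSpace na ∩ halfSpace nb ∩ halfSpace (-nc)) with hQc
  -- the other four octants
  have e1 : volume (ball₃ R ∩ halfSpace (-na) ∩ halfSpace (-nb) ∩ halfSpace (-nc)) = P :=
    volume_inter_halfSpaces_neg R na nb nc
  have e2 : volume (ball₃ R ∩ halfSpace na ∩ halfSpace (-nb) ∩ halfSpace (-nc)) = Qa := by
    have := volume_inter_halfSpaces_neg R (-na) nb nc; rw [neg_neg] at this; exact this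
  have e3 : volume (ball₃ R ∩ halfSpace (-na) ∩ halfSpace nb ∩ halfSpace (-nc)) = Qb := by
    have := volume_inter_halfSpaces_neg R na (-nb) nc; rw [neg_neg] at this; exact this
  have e4 : volume (ball₃ R ∩ halfSpace (-na) ∩ halfSpace (-nb) ∩ halfSpace nc) = Qc := by
    have := volume_inter_halfSpaces_neg R na nb (-nc); rw [neg_neg] at this; exact this
  -- the ball as the sum of eight octants
  have hball : volume (ball₃ R) = 2 * (P + Qa + Qb + Qc) := by
    rw [volume_eq_add_halfSpace hB ha]
    rw [volume_eq_add_halfSpace (hB.inter (hH _)) hb, volume_eq_add_halfSpace (hB.inter (hH _)) hb]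
    rw [volume_eq_add_halfSpace ((hB.inter (hH _)).inter (hH _)) hc,
      volume_eq_add_halfSpace ((hB.inter (hH _)).inter (hH _)) hc,
      volume_eq_add_halfSpace ((hB.inter (hH _)).inter (hH _)) hc,
      volume_eq_add_halfSpace ((hB.inter (hH _)).inter (hH _)) hc]
    rw [e1, e2, e3, e4, ← hP, ← hQa, ← hQb, ← hQc]
    ring
  -- the three lunes as sums of two octants
  have hla : volume (lune nb nc ∩ ball₃ R) = P + Qa := by
    have hset : lune nb nc ∩ ball₃ R = ball₃ R ∩ halfSpace nb ∩ halfSpace nc := by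
      ext x; simp only [lune, mem_inter_iff]; tauto
    rw [hset, volume_eq_add_halfSpace ((hB.inter (hH _)).inter (hH _)) ha]
    congr 1
    · rw [hP]; congr 1; ext x; simp only [mem_inter_iff]; tauto
    · rw [hQa]; congr 1; ext x; simp only [mem_inter_iff]; tauto
  have hlb : volume (lune nc na ∩ ball₃ R) = P + Qb := by
    have hset : lune nc na ∩ ball₃ R = ball₃ R ∩ halfSpace na ∩ halfSpace nc := by
      ext x; simp only [lune, mem_inter_iff]; tauto
    rw [hset, volume_eq_add_halfSpace ((hB.inter (hH _)).inter (hH _)) hb]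
    congr 1
    · rw [hP]; congr 1; ext x; simp only [mem_inter_iff]; tauto
    · rw [hQb]; congr 1; ext x; simp only [mem_inter_iff]; tauto
  have hlc : volume (lune na nb ∩ ball₃ R) = P + Qc := by
    have hset : lune na nb ∩ ball₃ R = ball₃ R ∩ halfSpace na ∩ halfSpace nb := by
      ext x; simp only [lune, mem_inter_iff]; tauto
    rw [hset, volume_eq_add_halfSpace ((hB.inter (hH _)).inter (hH _)) hc]
  have hT : volume (triCone a b c ∩ ball₃ R) = P := by
    rw [hP]; congr 1; ext x; simp only [triCone, mem_inter_iff]; tauto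
  rw [hla, hlb, hlc, hT, hball]
  ring

end Girard

section GirardReal

variable {a b c : Fin 3 → ℝ}

/-- `(c × a) × (a × b) = [a, b, c] a`. [folklore] -/
theorem cross_ca_cross_ab (a b c : Fin 3 → ℝ) : (c ⨯₃ a) ⨯₃ (a ⨯₃ b) = (a ⬝ᵥ (b ⨯₃ c)) • a := by
  ext i; fin_cases i <;>
    · simp [cross_apply, dotProduct, Fin.sum_univ_three]; ring

/-- `[a,b,c] > 0 ⇒ a ≠ 0`. [folklore] -/
theorem left_ne_zero_of_triple_pos (hτ : 0 < a ⬝ᵥ (b ⨯₃ c)) : a ≠ 0 := by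
  rintro rfl; simp at hτ

/-- `[a,b,c] > 0 ⇒ b × c ≠ 0`. [folklore] -/
theorem cross_bc_ne_zero_of_triple_pos (hτ : 0 < a ⬝ᵥ (b ⨯₃ c)) : b ⨯₃ c ≠ 0 := by
  intro h; rw [h] at hτ; simp at hτ

/-- The normals of two faces of a proper trihedral cone are independent. [folklore] -/
theorem cross_normals_ne_zero (hτ : 0 < a ⬝ᵥ (b ⨯₃ c)) : (c ⨯₃ a) ⨯₃ (a ⨯₃ b) ≠ 0 := by
  rw [cross_ca_cross_ab]
  exact smul_ne_zero hτ.ne' (left_ne_zero_of_triple_pos hτ)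

/-- The round ball has finite volume. [folklore] -/
theorem volume_ball₃_lt_top (R : ℝ) : volume (ball₃ R) < ⊤ := by
  apply lt_of_le_of_lt (measure_mono (_ : ball₃ R ⊆ Metric.closedBall (0 : Fin 3 → ℝ) (Real.sqrt |R|)))
  · exact measure_closedBall_lt_top
  · intro x hx
    rw [mem_closedBall_zero_iff, pi_norm_le_iff_of_nonneg (Real.sqrt_nonneg _)]
    intro i
    rw [Real.norm_eq_abs, ← Real.sqrt_sq_eq_abs]
    apply Real.sqrt_le_sqrt
    have hx' : x ⬝ᵥ x < R := hx
    rw [dotProduct_self_fin3] at hx'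
    have : x i ^ 2 ≤ x 0 ^ 2 + x 1 ^ 2 + x 2 ^ 2 := by
      fin_cases i <;> simp <;> nlinarith [sq_nonneg (x 0), sq_nonneg (x 1), sq_nonneg (x 2)]
    calc x i ^ 2 ≤ x 0 ^ 2 + x 1 ^ 2 + x 2 ^ 2 := this
      _ ≤ |R| := by linarith [le_abs_self R]

/-- **Girard's theorem.** The open trihedral cone positively spanned by `a, b, c` occupies the
fraction `(θ_a + θ_b + θ_c - π)/(4π)` of the round ball, where `θ_a, θ_b, θ_c` are its dihedral
angles. Equivalently the spherical triangle `â b̂ ĉ` has area equal to its angular excess.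
[folklore] (Girard 1629; this is the `p = 3` case of "`A(F*) = Θ(F*) - (p-2)π`" in
[cite: KishimotoYoneda2022, §4 Lemma 4.6 (proof)].) -/
theorem girard (hτ : 0 < a ⬝ᵥ (b ⨯₃ c)) (R : ℝ) :
    4 * π * (volume (triCone a b c ∩ ball₃ R)).toReal
      = (dihedral c a b + dihedral a b c + dihedral b c a - π) * (volume (ball₃ R)).toReal := by
  have hτb : 0 < b ⬝ᵥ (c ⨯₃ a) := by rwa [triple_product_cyclic]
  have hτc : 0 < c ⬝ᵥ (a ⨯₃ b) := by rw [triple_product_cyclic, triple_product_cyclic]; exact hτ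
  have ha := cross_bc_ne_zero_of_triple_pos hτ
  have hb := cross_bc_ne_zero_of_triple_pos hτb
  have hc := cross_bc_ne_zero_of_triple_pos hτc
  have hka : (c ⨯₃ a) ⨯₃ (a ⨯₃ b) ≠ 0 := cross_normals_ne_zero hτ
  have hkb : (a ⨯₃ b) ⨯₃ (b ⨯₃ c) ≠ 0 := cross_normals_ne_zero hτb
  have hkc : (b ⨯₃ c) ⨯₃ (c ⨯₃ a) ≠ 0 := cross_normals_ne_zero hτc
  have key := two_mul_sum_lunes R ha hb hc
  rw [volume_lune_inter_ball₃ hka, volume_lune_inter_ball₃ hkb, volume_lune_inter_ball₃ hkc] at key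
  -- pass to real numbers
  have hV := volume_ball₃_lt_top R
  have hT : volume (triCone a b c ∩ ball₃ R) < ⊤ := lt_of_le_of_lt (measure_mono inter_subset_right) hV
  set V := volume (ball₃ R) with hVdef
  set T := volume (triCone a b c ∩ ball₃ R) with hTdef
  have hθa := (luneAngle_mem_Ioo hka).1
  have hθb := (luneAngle_mem_Ioo hkb).1
  have hθc := (luneAngle_mem_Ioo hkc).1
  unfold dihedral
  set θa := luneAngle (c ⨯₃ a) (a ⨯₃ b)
  set θb := luneAngle (a ⨯₃ b) (b ⨯₃ c)
  set θc := luneAngle (b ⨯₃ c) (c ⨯₃ a)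
  have h2π : 0 < 2 * π := by positivity
  have key' := congrArg ENNReal.toReal key
  rw [ENNReal.toReal_mul, ENNReal.toReal_add (by finiteness) (by finiteness),
    ENNReal.toReal_add (by finiteness) (by finiteness), ENNReal.toReal_mul, ENNReal.toReal_mul,
    ENNReal.toReal_mul, ENNReal.toReal_ofReal (div_nonneg hθa.le h2π.le),
    ENNReal.toReal_ofReal (div_nonneg hθb.le h2π.le), ENNReal.toReal_ofReal (div_nonneg hθc.le h2π.le),
    ENNReal.toReal_add (by finiteness) hV.ne, ENNReal.toReal_mul] at key'
  simp only [ENNReal.toReal_ofNat] at key'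
  field_simp at key'
  linear_combination -key'

end GirardReal

end KY

end Literature.Analysis.FluidPDE
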